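import Summits.AnomalousDissipation.AnomalousDissipation.Theorems.SolenoidalFractalHomogenisationLagrangianStepCellLawVQSPinch
import Summits.AnomalousDissipation.AnomalousDissipation.Theorems.SolenoidalFractalHomogenisationLagrangianStepOneLevelDefsSectorial
import HarnessLib

/-!
# Sectorial NON-EXPANSION of the quasi-static excess map (p5's (L3) `NonExpansion`, PROVED from the per-slot hypothesis (L1⁺)) (K1L_D helper)

Helper file of route `SolenoidalFractalHomogenisation`, crux K1L_D `LagrangianRenormalisationStepDesign` (stmt-AnomalousDissipation-27980), registered
stub `stub_cellLawV0_IS` (W5 sectorial window, odd half).  Planner ad-ideate-p5 g7's certificate chain (`Cruxes/LagrangianRenormalisationStep/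
OddGainCertificateSketch.lean` v2, (L0)–(L3); cell STATUS 2026-08-28T15:08:36Z «κ ≤ 1 ALWAYS») asserts: if every SLOT RESPONSE `f_T = qsResp ρ T`
is sector-non-expanding on blocks in the window, then the quasi-static excess map `S ↦ N⁻¹·excQS W M S` maps the Kato sector `OddSectorial · τ` into
itself — for EVERY background `S` in the near-isotropy window and every `τ`, with NO window on the output (`κ ≤ 1`).  This file PROVES that
implication on the Theorems side, over the cellLawV worker's landed vocabulary (`excQS`, `slotQ`, `slotCoef`, `qsResp`, `regBlock`, `projPerp`;
p642614/p643071/p643421):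

* (L0) is the LANDED line form `bsymb_excQS` (p643421): `β_{excQS}(k;p,q) = Σ_s coef_s (e_s·k)² · pᵀ Q_s q`, `Q_s = f_{T_s}(B̂_s) P_s`;
* `dotProduct_regBlock_mulVec`: the bilinear form of the regularised block `B̂ = PΣP + nnᵀ` is `β_S(n; Px, Py) + (x·n)(n·y)`; hence
  `sectorForm_regBlock` (the block inherits the sector `τ` of `S`: `OddSectorial S τ ⇒ (xᵀB̂y − yᵀB̂x)² ≤ τ²(xᵀB̂x)(yᵀB̂y)`) and
  `window_regBlock` (`NearIso S lo hi`, `lo ≤ 1 ≤ hi` ⇒ `lo|x|² ≤ xᵀB̂x ≤ hi|x|²`);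
* `sector_finset_sum`: nonnegative combinations of sector-`τ` bilinear forms with nonnegative diagonals are sector-`τ` (p4's `sector_add_aux`, iterated);
* **`oddSectorial_excQS_of_slot`** / **`oddSectorial_smul_excQS_of_slot`**: (L1⁺) per slot ⇒ `OddSectorial (excQS W M S) τ` and
  `OddSectorial ((1/N)•excQS W M S) τ`.

TYPING REMARKS (for p5 / the tenure; `stub-misstated`-class, harmless): (i) the per-slot hypothesis must include NONNEGATIVITY of the response's
quadratic form (`0 ≤ xᵀ f_T(B) x`), which p5's `QsRespSectorNonexpansive` omits — a sector condition alone fixes the sign of the form only up to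
±, and the slot sum needs `+`; (ii) the spectral premise of (L1) is checked for `B̂_s` only when the window contains `1` (`lo ≤ 1 ≤ hi`: the `n`-direction
of `B̂` has eigenvalue `1`), which p5's `NonExpansion` binder list omits.  With (i)+(ii) the statement below is p5's (L3) with (L0) discharged.
No definitions, no named facts, no sorry.  NOT a proof of the stub, of the crux, of Onsager's conjecture or of anomalous dissipation — rung-leaf
F-D1.A0 algebra.  Prover seat `ad-k3l-bookkeeping-p1` g4 (O3(ii)), 2026-08-28.
-/

set_option linter.dupNamespace false

noncomputable section

namespace Summit.AnomalousDissipation.AnomalousDissipation.Theorems.SolenoidalFractalHomogenisation.LagrangianStep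

open Literature.Analysis Literature.Analysis.FluidPDE Literature.Analysis.FunctionSpaces
open Finset Matrix

/-! ## The bilinear form of the regularised block -/

section Block

variable {S : Torus.Visc4 (Fin 3)} {n : Fin 3 → ℝ}

/-- `P_n` is a symmetric matrix. [folklore] -/
theorem projPerp_transpose (n : Fin 3 → ℝ) : (projPerp n)ᵀ = projPerp n := by
  ext i j
  exact projPerp_apply_comm n j i

/-- `x ⬝ (P_n z) = (P_n x) ⬝ z`. [folklore] -/
theorem dotProduct_projPerp_mulVec (n x z : Fin 3 → ℝ) : x ⬝ᵥ (projPerp n) *ᵥ z = ((projPerp n) *ᵥ x) ⬝ᵥ z := by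
  rw [Matrix.dotProduct_mulVec, ← Matrix.mulVec_transpose, projPerp_transpose]

/-- `(n nᵀ) z = (n ⬝ z) n`. [folklore] -/
theorem vecMulVec_mulVec_apply (n z : Fin 3 → ℝ) (i : Fin 3) : ((Matrix.vecMulVec n n) *ᵥ z) i = n i * ∑ j, n j * z j := by
  simp only [Matrix.mulVec, dotProduct, Matrix.vecMulVec_apply, mul_assoc, Finset.mul_sum]

/-- **The bilinear form of `B̂ = P Σ P + n nᵀ`**: `xᵀ B̂ y = β_S(n; P x, P y) + (x·n)(n·y)`. [folklore] -/
theorem dotProduct_regBlock_mulVec (S : Torus.Visc4 (Fin 3)) (n x y : Fin 3 → ℝ) :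
    x ⬝ᵥ (regBlock S n) *ᵥ y =
      Torus.bsymb S n ((projPerp n) *ᵥ x) ((projPerp n) *ᵥ y) + (∑ i, x i * n i) * (∑ j, n j * y j) := by
  rw [regBlock, Matrix.add_mulVec, dotProduct_add, ← Matrix.mulVec_mulVec, ← Matrix.mulVec_mulVec, dotProduct_projPerp_mulVec]
  congr 1
  · rw [dotProduct, sum_mul_mulVec_eq_sum_sum, sum_sum_mul_sigMat_mul]
  · simp only [dotProduct, vecMulVec_mulVec_apply, ← mul_assoc, ← Finset.sum_mul]

/-- `Σ x_i n_i = Σ n_j x_j`. [folklore] -/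
theorem sum_mul_comm' (x n : Fin 3 → ℝ) : ∑ i, x i * n i = ∑ j, n j * x j :=
  Finset.sum_congr rfl fun _ _ => mul_comm _ _

/-- The antisymmetric part of `B̂`'s form is that of `β_S(n;·,·)` on the projected vectors. [folklore] -/
theorem dotProduct_regBlock_mulVec_sub (S : Torus.Visc4 (Fin 3)) (n x y : Fin 3 → ℝ) :
    x ⬝ᵥ (regBlock S n) *ᵥ y - y ⬝ᵥ (regBlock S n) *ᵥ x =
      Torus.bsymb S n ((projPerp n) *ᵥ x) ((projPerp n) *ᵥ y) - Torus.bsymb S n ((projPerp n) *ᵥ y) ((projPerp n) *ᵥ x) := by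
  rw [dotProduct_regBlock_mulVec, dotProduct_regBlock_mulVec, sum_mul_comm' x n, sum_mul_comm' y n]
  ring

/-- The quadratic form of `B̂`: `xᵀ B̂ x = σ_S(n, P x) + (x·n)²`. [folklore] -/
theorem dotProduct_regBlock_mulVec_self (S : Torus.Visc4 (Fin 3)) (n x : Fin 3 → ℝ) :
    x ⬝ᵥ (regBlock S n) *ᵥ x = Torus.symb S n ((projPerp n) *ᵥ x) + (∑ i, x i * n i) ^ 2 := by
  rw [dotProduct_regBlock_mulVec, Torus.symb_eq_bsymb, ← sum_mul_comm' x n, sq]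

/-- `P_n x ⊥ n` in the orientation `Σ (P x)_i n_i = 0` used by `OddSectorial` / `NearIso`. [folklore] -/
theorem projPerp_mulVec_perp (hn : ∑ a, n a ^ 2 = 1) (x : Fin 3 → ℝ) : ∑ i, ((projPerp n) *ᵥ x) i * n i = 0 := by
  rw [sum_mul_comm']
  exact sum_mul_projPerp_mulVec hn x

/-- The transverse symbol of a projected vector is nonnegative in an elliptic window. [folklore] -/
theorem symb_projPerp_nonneg (hn : ∑ a, n a ^ 2 = 1) {lo hi : ℝ} (hS : Torus.NearIso S lo hi) (hlo : 0 ≤ lo) (x : Fin 3 → ℝ) :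
    0 ≤ Torus.symb S n ((projPerp n) *ᵥ x) := by
  have h := (hS n ((projPerp n) *ᵥ x) (projPerp_mulVec_perp hn x)).1
  rw [hn, one_mul] at h
  exact le_trans (mul_nonneg hlo (Finset.sum_nonneg fun i _ => sq_nonneg _)) h

/-- **The regularised block inherits the sector of `S`**: `OddSectorial S τ` ⇒ `B̂(S, n)` satisfies the Kato-sector condition with the same `τ`
(unit `n`, elliptic window so that the diagonal symbols are nonnegative). [folklore] -/
theorem sectorForm_regBlock (hn : ∑ a, n a ^ 2 = 1) {lo hi τ : ℝ} (hS : Torus.NearIso S lo hi) (hlo : 0 ≤ lo)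
    (hodd : OddSectorial S τ) (x y : Fin 3 → ℝ) :
    (x ⬝ᵥ (regBlock S n) *ᵥ y - y ⬝ᵥ (regBlock S n) *ᵥ x) ^ 2 ≤
      τ ^ 2 * ((x ⬝ᵥ (regBlock S n) *ᵥ x) * (y ⬝ᵥ (regBlock S n) *ᵥ y)) := by
  rw [dotProduct_regBlock_mulVec_sub, dotProduct_regBlock_mulVec_self, dotProduct_regBlock_mulVec_self]
  have h := hodd n ((projPerp n) *ᵥ x) ((projPerp n) *ᵥ y) (projPerp_mulVec_perp hn x) (projPerp_mulVec_perp hn y)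
  have hpx := symb_projPerp_nonneg hn hS hlo x
  have hpy := symb_projPerp_nonneg hn hS hlo y
  refine h.trans (mul_le_mul_of_nonneg_left ?_ (sq_nonneg τ))
  exact mul_le_mul (le_add_of_nonneg_right (sq_nonneg _)) (le_add_of_nonneg_right (sq_nonneg _)) hpy
    (hpx.trans (le_add_of_nonneg_right (sq_nonneg _)))

/-- **The regularised block lies in the spectral window `[lo, hi]`** when `NearIso S lo hi` and the window contains `1` (the `n`-direction of
`B̂` has eigenvalue `1`). [folklore] -/
theorem window_regBlock (hn : ∑ a, n a ^ 2 = 1) {lo hi : ℝ} (hS : Torus.NearIso S lo hi) (hlo1 : lo ≤ 1) (hhi1 : 1 ≤ hi)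
    (x : Fin 3 → ℝ) :
    lo * (x ⬝ᵥ x) ≤ x ⬝ᵥ (regBlock S n) *ᵥ x ∧ x ⬝ᵥ (regBlock S n) *ᵥ x ≤ hi * (x ⬝ᵥ x) := by
  rw [dotProduct_regBlock_mulVec_self]
  have hw := hS n ((projPerp n) *ᵥ x) (projPerp_mulVec_perp hn x)
  rw [hn, one_mul, sum_sq_projPerp_mulVec hn x] at hw
  have hxx : x ⬝ᵥ x = ∑ i, x i ^ 2 := by simp only [dotProduct, sq]
  rw [hxx]
  have hc : 0 ≤ (∑ i, x i * n i) ^ 2 := sq_nonneg _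
  constructor
  · nlinarith [hw.1]
  · nlinarith [hw.2]

end Block

/-! ## Sums of sector forms -/

/-- **Nonnegative combinations of sector-`τ` forms are sector-`τ`** (p4's `sector_add_aux`, iterated over a finset): if for every `s ∈ t`,
`(X s − Y s)² ≤ τ²·(A s)(B s)` with `A s, B s ≥ 0` and weights `c s ≥ 0`, then
`(Σ c X − Σ c Y)² ≤ τ²·(Σ c A)(Σ c B)`. [folklore] -/
theorem sector_finset_sum {ι : Type*} (t : Finset ι) (c X Y A B : ι → ℝ) {τ : ℝ} (hc : ∀ s ∈ t, 0 ≤ c s)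
    (hA : ∀ s ∈ t, 0 ≤ A s) (hB : ∀ s ∈ t, 0 ≤ B s) (h : ∀ s ∈ t, (X s - Y s) ^ 2 ≤ τ ^ 2 * (A s * B s)) :
    (∑ s ∈ t, c s * X s - ∑ s ∈ t, c s * Y s) ^ 2 ≤ τ ^ 2 * ((∑ s ∈ t, c s * A s) * (∑ s ∈ t, c s * B s)) := by
  classical
  induction t using Finset.induction_on with
  | empty => simp
  | @insert a t hat ih =>
    have hc' : ∀ s ∈ t, 0 ≤ c s := fun s hs => hc s (Finset.mem_insert_of_mem hs)
    have hA' : ∀ s ∈ t, 0 ≤ A s := fun s hs => hA s (Finset.mem_insert_of_mem hs)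
    have hB' : ∀ s ∈ t, 0 ≤ B s := fun s hs => hB s (Finset.mem_insert_of_mem hs)
    have h' : ∀ s ∈ t, (X s - Y s) ^ 2 ≤ τ ^ 2 * (A s * B s) := fun s hs => h s (Finset.mem_insert_of_mem hs)
    have ih' := ih hc' hA' hB' h'
    rw [Finset.sum_insert hat, Finset.sum_insert hat, Finset.sum_insert hat, Finset.sum_insert hat]
    have hca := hc a (Finset.mem_insert_self a t)
    -- the new slot: `(cX − cY)² = c²(X−Y)² ≤ τ²(cA)(cB)`
    have h1 : (c a * X a - c a * Y a) ^ 2 ≤ τ ^ 2 * ((c a * A a) * (c a * B a)) := by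
      have := h a (Finset.mem_insert_self a t)
      calc (c a * X a - c a * Y a) ^ 2 = c a ^ 2 * (X a - Y a) ^ 2 := by ring
        _ ≤ c a ^ 2 * (τ ^ 2 * (A a * B a)) := mul_le_mul_of_nonneg_left this (sq_nonneg _)
        _ = τ ^ 2 * ((c a * A a) * (c a * B a)) := by ring
    have hSA : 0 ≤ ∑ s ∈ t, c s * A s := Finset.sum_nonneg fun s hs => mul_nonneg (hc' s hs) (hA' s hs)
    have hSB : 0 ≤ ∑ s ∈ t, c s * B s := Finset.sum_nonneg fun s hs => mul_nonneg (hc' s hs) (hB' s hs)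
    have e : c a * X a + ∑ s ∈ t, c s * X s - (c a * Y a + ∑ s ∈ t, c s * Y s) =
        (c a * X a - c a * Y a) + (∑ s ∈ t, c s * X s - ∑ s ∈ t, c s * Y s) := by ring
    rw [e]
    exact sector_add_aux (mul_nonneg hca (hA a (Finset.mem_insert_self a t))) (mul_nonneg hca (hB a (Finset.mem_insert_self a t)))
      hSA hSB h1 ih'

/-! ## Non-expansion -/

variable {k : ℕ}

/-- The bilinear form of the slot response matrix `Q_s = f_{T_s}(B̂_s)·P_s` as a `dotProduct` on the projected vectors. [folklore] -/
theorem slotQ_form_eq (W : LatticeShear.LatticeWord k) (M : ℝ) (S : Torus.Visc4 (Fin 3)) (s : Fin k) (p q : Fin 3 → ℝ) :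
    ∑ i, ∑ j, p i * slotQ W M S s i j * q j =
      ((projPerp (mhat (W.phase s))) *ᵥ p) ⬝ᵥ
        (qsResp W.ramp (4 * Real.pi ^ 2 * ‖Torus.latticeVec (W.phase s).m‖ ^ 2 * M * (W.phase s).τ) (regBlock S (mhat (W.phase s)))) *ᵥ
          ((projPerp (mhat (W.phase s))) *ᵥ q) := by
  rw [slotQ, sum_sum_mul_qsResp_regBlock_projPerp (sum_mhat_sq (W.phase s)), dotProduct, sum_mul_mulVec_eq_sum_sum]

/-- **NON-EXPANSION (p5's (L3), PROVED from the per-slot hypothesis (L1⁺))**: if for every slot `s` the quasi-static response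
`f_{T_s} = qsResp ρ T_s` maps every block `B` that is in the Kato sector `τ` with spectrum in `[lo, hi]` to a matrix in the sector `τ` with
NONNEGATIVE quadratic form, then for every background `S` with `NearIso S lo hi` (`0 ≤ lo ≤ 1 ≤ hi`) in the sector `τ` the quasi-static excess
`excQS W M S` is in the sector `τ` — no window on the output. [folklore] -/
theorem oddSectorial_excQS_of_slot (W : LatticeShear.LatticeWord k) (M : ℝ) {lo hi τ : ℝ} (hlo : 0 ≤ lo) (hlo1 : lo ≤ 1) (hhi1 : 1 ≤ hi)
    (hL1 : ∀ s : Fin k, ∀ B : Matrix (Fin 3) (Fin 3) ℝ,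
      (∀ x y : Fin 3 → ℝ, (x ⬝ᵥ B *ᵥ y - y ⬝ᵥ B *ᵥ x) ^ 2 ≤ τ ^ 2 * ((x ⬝ᵥ B *ᵥ x) * (y ⬝ᵥ B *ᵥ y))) →
      (∀ x : Fin 3 → ℝ, lo * (x ⬝ᵥ x) ≤ x ⬝ᵥ B *ᵥ x ∧ x ⬝ᵥ B *ᵥ x ≤ hi * (x ⬝ᵥ x)) →
      (∀ x y : Fin 3 → ℝ,
        (x ⬝ᵥ (qsResp W.ramp (4 * Real.pi ^ 2 * ‖Torus.latticeVec (W.phase s).m‖ ^ 2 * M * (W.phase s).τ) B) *ᵥ y -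
         y ⬝ᵥ (qsResp W.ramp (4 * Real.pi ^ 2 * ‖Torus.latticeVec (W.phase s).m‖ ^ 2 * M * (W.phase s).τ) B) *ᵥ x) ^ 2 ≤
        τ ^ 2 * ((x ⬝ᵥ (qsResp W.ramp (4 * Real.pi ^ 2 * ‖Torus.latticeVec (W.phase s).m‖ ^ 2 * M * (W.phase s).τ) B) *ᵥ x) *
          (y ⬝ᵥ (qsResp W.ramp (4 * Real.pi ^ 2 * ‖Torus.latticeVec (W.phase s).m‖ ^ 2 * M * (W.phase s).τ) B) *ᵥ y))) ∧
      (∀ x : Fin 3 → ℝ, 0 ≤ x ⬝ᵥ (qsResp W.ramp (4 * Real.pi ^ 2 * ‖Torus.latticeVec (W.phase s).m‖ ^ 2 * M * (W.phase s).τ) B) *ᵥ x))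
    {S : Torus.Visc4 (Fin 3)} (hS : Torus.NearIso S lo hi) (hodd : OddSectorial S τ) :
    OddSectorial (excQS W M S) τ := by
  intro κ p q _hp _hq
  rw [Torus.symb_eq_bsymb, Torus.symb_eq_bsymb, bsymb_excQS, bsymb_excQS, bsymb_excQS, bsymb_excQS]
  -- per slot: weight `c_s = coef_s (e_s·κ)² ≥ 0` and the sector data of the response form on the projected vectors
  have hslot : ∀ s : Fin k,
      (∑ i, ∑ j, p i * slotQ W M S s i j * q j - ∑ i, ∑ j, q i * slotQ W M S s i j * p j) ^ 2 ≤
        τ ^ 2 * ((∑ i, ∑ j, p i * slotQ W M S s i j * p j) * (∑ i, ∑ j, q i * slotQ W M S s i j * q j)) ∧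
      0 ≤ ∑ i, ∑ j, p i * slotQ W M S s i j * p j ∧ 0 ≤ ∑ i, ∑ j, q i * slotQ W M S s i j * q j := by
    intro s
    have hn := sum_mhat_sq (W.phase s)
    obtain ⟨hsec, hpos⟩ := hL1 s (regBlock S (mhat (W.phase s)))
      (sectorForm_regBlock hn hS hlo hodd) (window_regBlock hn hS hlo1 hhi1)
    rw [slotQ_form_eq, slotQ_form_eq, slotQ_form_eq, slotQ_form_eq]
    exact ⟨hsec _ _, hpos _, hpos _⟩
  have h := sector_finset_sum (Finset.univ : Finset (Fin k))
    (fun s => slotCoef W s * (∑ a, (W.phase s).e a * κ a) ^ 2)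
    (fun s => ∑ i, ∑ j, p i * slotQ W M S s i j * q j) (fun s => ∑ i, ∑ j, q i * slotQ W M S s i j * p j)
    (fun s => ∑ i, ∑ j, p i * slotQ W M S s i j * p j) (fun s => ∑ i, ∑ j, q i * slotQ W M S s i j * q j)
    (fun s _ => mul_nonneg (slotCoef_nonneg W s) (sq_nonneg _)) (fun s _ => (hslot s).2.1) (fun s _ => (hslot s).2.2)
    (fun s _ => (hslot s).1)
  simpa only [mul_assoc] using h

/-- … and therefore the NORMALISED excess `N⁻¹·excQS W M S` as well (the sector is scale invariant, `OddSectorial.smul`): p5's `NonExpansion` with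
(L0) discharged by `bsymb_excQS` and (L1) taken in the strengthened form (L1⁺). [folklore] -/
theorem oddSectorial_smul_excQS_of_slot (W : LatticeShear.LatticeWord k) (M N : ℝ) {lo hi τ : ℝ} (hlo : 0 ≤ lo) (hlo1 : lo ≤ 1)
    (hhi1 : 1 ≤ hi)
    (hL1 : ∀ s : Fin k, ∀ B : Matrix (Fin 3) (Fin 3) ℝ,
      (∀ x y : Fin 3 → ℝ, (x ⬝ᵥ B *ᵥ y - y ⬝ᵥ B *ᵥ x) ^ 2 ≤ τ ^ 2 * ((x ⬝ᵥ B *ᵥ x) * (y ⬝ᵥ B *ᵥ y))) →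
      (∀ x : Fin 3 → ℝ, lo * (x ⬝ᵥ x) ≤ x ⬝ᵥ B *ᵥ x ∧ x ⬝ᵥ B *ᵥ x ≤ hi * (x ⬝ᵥ x)) →
      (∀ x y : Fin 3 → ℝ,
        (x ⬝ᵥ (qsResp W.ramp (4 * Real.pi ^ 2 * ‖Torus.latticeVec (W.phase s).m‖ ^ 2 * M * (W.phase s).τ) B) *ᵥ y -
         y ⬝ᵥ (qsResp W.ramp (4 * Real.pi ^ 2 * ‖Torus.latticeVec (W.phase s).m‖ ^ 2 * M * (W.phase s).τ) B) *ᵥ x) ^ 2 ≤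
        τ ^ 2 * ((x ⬝ᵥ (qsResp W.ramp (4 * Real.pi ^ 2 * ‖Torus.latticeVec (W.phase s).m‖ ^ 2 * M * (W.phase s).τ) B) *ᵥ x) *
          (y ⬝ᵥ (qsResp W.ramp (4 * Real.pi ^ 2 * ‖Torus.latticeVec (W.phase s).m‖ ^ 2 * M * (W.phase s).τ) B) *ᵥ y))) ∧
      (∀ x : Fin 3 → ℝ, 0 ≤ x ⬝ᵥ (qsResp W.ramp (4 * Real.pi ^ 2 * ‖Torus.latticeVec (W.phase s).m‖ ^ 2 * M * (W.phase s).τ) B) *ᵥ x))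
    {S : Torus.Visc4 (Fin 3)} (hS : Torus.NearIso S lo hi) (hodd : OddSectorial S τ) :
    OddSectorial ((1 / N) • excQS W M S) τ :=
  (oddSectorial_excQS_of_slot W M hlo hlo1 hhi1 hL1 hS hodd).smul (1 / N)

end Summit.AnomalousDissipation.AnomalousDissipation.Theorems.SolenoidalFractalHomogenisation.LagrangianStep

end
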